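import Literature.Probability.RandomPlanarGeometry.LoewnerDescription
import Literature.Probability.RandomPlanarGeometry.LoewnerGrowth
import Literature.Probability.RandomPlanarGeometry.LoewnerHullCapacity
import Literature.Probability.RandomPlanarGeometry.BoundaryCorrespondence
import Literature.Probability.RandomPlanarGeometry.ConformalMapCaratheodoryProofs
import HarnessLib

/-!
# Uniqueness of the driving function of a curve class: discharge of `driving_unique`

Proof-only file. It discharges the named fact
`Literature.Probability.RandomPlanarGeometry.IsLoewnerDescribed.driving_unique` of
`LoewnerDescription.lean`: if a curve class `c` in the Dobrushin domain `(D; a, b)` is described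
by the Loewner evolution (through a chordal uniformizing map `φ : ℍ → D`) with the continuous
driving functions `W` and `W'`, then `W = W'` (G. F. Lawler, *Conformally Invariant Processes in
the Plane*, AMS (2005), §4.1: an increasing family of hulls determines its Loewner transform;
Thm. 4.6: `g_t` is the unique conformal transformation of `H_t` onto `ℍ` with `g_t(z) - z → 0`,
`g_t(z) = z + 2t/z + O(|z|⁻²)`).

The printed argument, and the one formalised here:

1. *Curves modulo reparametrisation determine their initial segments*
   (`Curve.exists_image_Iic_eq_of_dist_eq_zero`): two parametrised curves at reparametrisation
   distance `0` (Aizenman–Burchard metric, `Curve.lean`) have the same family of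
   initial-segment traces `{γ[0, s]}`: reparametrisations `ψₙ` with `‖γ - γ' ∘ ψₙ‖ < 1/(n+1)`
   and a subsequential limit `s₂` of `ψₙ s` give `γ[0, s] = γ'[0, s₂]`.
2. *Pull-back to `ℍ`*: the boundary extension of `φ` is injective on the closed half-plane and
   does not take the value `b` there (Carathéodory, Pommerenke (1992), Thm. 2.6, the tree's
   `JordanDomain.exists_continuousOn_extension_holds`; `MarkedDomain.boundaryExtension_ne_pt_one`),
   so the two generating curves have the same family of initial segments, hence
   (`Loewner.IsGeneratedByCurve.hull_eq`) the two chains have the same family of hulls: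
   `∀ t, ∃ t', K_t = K'_{t'}`.
3. *Half-plane capacity fixes the time* (`Loewner.eq_of_hull_eq`): `hcap K_t = 2t` (the tree's
   `Loewner.hcap_hull_eq`, Lawler Thm. 4.6 / eq. (4.6)), and the half-plane capacity of a hull
   does not depend on the hydrodynamically normalised map used to compute it
   (`IsHydrodynamicMap.hcap_eq_hcap`, from the additivity `hcap(φ₂ ∘ φ₁⁻¹) = hcap φ₂ - hcap φ₁`
   and `hcap ≥ 0`, Lawler (3.8)/(3.10)); so `K_t = K'_{t'}` forces `t = t'`.
4. *The hulls determine the driving function* (`Loewner.driving_eq_of_hull_eq`, Lawler §4.1,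
   p. 96: "`{K_t}` is right continuous at `t` with limit `U_t` if `⋂_δ cl K_{t,t+δ}` is the
   single point `U_t`"): equal hulls give equal maps `g_t` (uniqueness in Thm. 4.6, via the
   rigidity theorem `Complex.eqOn_id_of_tendsto_sub_self`), hence equal shifted hulls
   `K_{s,s+u} = g_s(K_{s+u} ∖ K_s)` (Rem. 4.9, the tree's `Loewner.mem_hull_iff_map_mem_hull`),
   which are nonempty (`Loewner.hull_nonempty`) and shrink to `W s`, resp. `W' s`, as `u ↓ 0`
   (Lemma 4.13, `Loewner.norm_sub_lt_of_mem_hull`); so `W s = W' s`.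

## References

* G. F. Lawler, *Conformally Invariant Processes in the Plane*, AMS (2005), §3.4 ((3.8)–(3.10)),
  §4.1 (Thm. 4.6, Rem. 4.9, Lemma 4.13, p. 96 "Loewner transform", "continuously increasing
  hulls"). [Lawler2005]
* Ch. Pommerenke, *Boundary Behaviour of Conformal Maps*, Springer (1992), Thm. 2.6.
* M. Aizenman, A. Burchard, Duke Math. J. 99 (1999), §2.1 (curves modulo reparametrisation).
-/

noncomputable section

open Set Filter Topology Metric Bornology
open UpperHalfPlane (upperHalfPlaneSet isOpen_upperHalfPlaneSet)
open scoped NNReal unitInterval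

namespace Literature.Probability.RandomPlanarGeometry

/-! ### 1. Curves at reparametrisation distance zero have the same initial segments -/

namespace Curve

variable {E : Type*} [MetricSpace E]

/-- **Curves at reparametrisation distance zero have the same family of initial-segment
traces.** If `dist γ γ' = 0` (so `γ, γ'` define the same class in `CurveClass E`), then for every
`s` there is `s₂` with `γ[0, s] = γ'[0, s₂]`. Proof: reparametrisations `ψₙ` with
`‖γ - γ' ∘ ψₙ‖ < 1/(n+1)`; take a subsequential limit `s₂` of `ψₙ s` (Bolzano–Weierstrass on
`[0, 1]`); a point `γ r`, `r ≤ s`, is the limit of `γ' (ψₙ r)` with `ψₙ r ≤ ψₙ s`, and a point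
`γ' ρ`, `ρ ≤ s₂`, is the limit of `γ rₙ` with `rₙ = min s (ψₙ⁻¹ ρ)`. (Elementary; metric of
Aizenman–Burchard, Duke Math. J. 99 (1999), §2.1.) [folklore] -/
theorem exists_image_Iic_eq_of_dist_eq_zero {γ γ' : Curve E} (h : dist γ γ' = 0) (s : I) :
    ∃ s₂ : I, (γ : I → E) '' Iic s = (γ' : I → E) '' Iic s₂ := by
  have hγc : Continuous γ := γ.continuous
  have hγ'c : Continuous γ' := γ'.continuous
  -- reparametrisations realising distance `< 1 / (n + 1)`
  have hε : ∀ n : ℕ, dist γ γ' < 1 / ((n : ℝ) + 1) := fun n ↦ by rw [h]; positivity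
  choose ψ hψ using fun n ↦ exists_dist_reparam_lt (hε n)
  have hclose : ∀ n (r : I), dist (γ r) (γ' (ψ n r)) < 1 / ((n : ℝ) + 1) := fun n r ↦ by
    have h1 := ContinuousMap.dist_apply_le_dist (f := γ.toContinuousMap)
      (g := (γ'.reparam (ψ n)).toContinuousMap) (x := r)
    simp only [coe_toContinuousMap, reparam_apply] at h1
    exact h1.trans_lt (hψ n)
  -- rates along subsequences
  have hrate : ∀ {θ : ℕ → ℕ}, StrictMono θ →
      Tendsto (fun k ↦ 1 / ((θ k : ℝ) + 1)) atTop (𝓝 0) := fun {θ} hθ ↦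
    (tendsto_one_div_add_atTop_nhds_zero_nat (𝕜 := ℝ)).comp hθ.tendsto_atTop
  -- a subsequential limit `s₂` of `ψ n s`
  obtain ⟨s₂, φ, hφ, hs₂⟩ := CompactSpace.tendsto_subseq fun n ↦ ψ n s
  refine ⟨s₂, Subset.antisymm ?_ ?_⟩
  · rintro _ ⟨r, hr, rfl⟩
    -- a further subsequential limit `ρ` of `ψ (φ k) r`
    obtain ⟨ρ, φ', hφ', hρ⟩ := CompactSpace.tendsto_subseq fun k ↦ ψ (φ k) r
    have hρs₂ : ρ ≤ s₂ :=
      le_of_tendsto_of_tendsto' hρ (hs₂.comp hφ'.tendsto_atTop) fun k ↦ (ψ (φ (φ' k))).monotone hr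
    refine ⟨ρ, hρs₂, ?_⟩
    have h1 : Tendsto (fun k ↦ γ' (ψ (φ (φ' k)) r)) atTop (𝓝 (γ' ρ)) := (hγ'c.tendsto ρ).comp hρ
    have h2 : Tendsto (fun k ↦ γ' (ψ (φ (φ' k)) r)) atTop (𝓝 (γ r)) := by
      refine (tendsto_const_nhds (x := γ r)).congr_dist ?_
      refine squeeze_zero (fun _ ↦ dist_nonneg) (fun k ↦ (hclose (φ (φ' k)) r).le) ?_
      exact hrate (hφ.comp hφ')
    exact tendsto_nhds_unique h1 h2
  · rintro _ ⟨ρ, hρ, rfl⟩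
    -- times `r k ≤ s` with `ψ (φ k) (r k) = min (ψ (φ k) s) ρ`
    set r : ℕ → I := fun k ↦ min s ((ψ (φ k)).symm ρ) with hr_def
    have hr_le : ∀ k, r k ≤ s := fun k ↦ min_le_left _ _
    have hψr : ∀ k, ψ (φ k) (r k) = min (ψ (φ k) s) ρ := fun k ↦ by
      rw [hr_def, (ψ (φ k)).monotone.map_min, OrderIso.apply_symm_apply]
    obtain ⟨r₀, φ', hφ', hr₀⟩ := CompactSpace.tendsto_subseq r
    have hr₀s : r₀ ≤ s := le_of_tendsto' hr₀ fun k ↦ hr_le (φ' k)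
    refine ⟨r₀, hr₀s, ?_⟩
    have h1 : Tendsto (fun k ↦ γ (r (φ' k))) atTop (𝓝 (γ r₀)) := (hγc.tendsto r₀).comp hr₀
    have hmin : Tendsto (fun k ↦ ψ (φ (φ' k)) (r (φ' k))) atTop (𝓝 ρ) := by
      have h3 : Tendsto (fun k ↦ min (ψ (φ (φ' k)) s) ρ) atTop (𝓝 (min s₂ ρ)) :=
        ((hs₂.comp hφ'.tendsto_atTop).min tendsto_const_nhds)
      rw [min_eq_right hρ] at h3
      exact h3.congr fun k ↦ (hψr (φ' k)).symm
    have h2 : Tendsto (fun k ↦ γ (r (φ' k))) atTop (𝓝 (γ' ρ)) := by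
      have h3 : Tendsto (fun k ↦ γ' (ψ (φ (φ' k)) (r (φ' k)))) atTop (𝓝 (γ' ρ)) :=
        (hγ'c.tendsto ρ).comp hmin
      refine h3.congr_dist ?_
      refine squeeze_zero (fun _ ↦ dist_nonneg) (fun k ↦ ?_) (hrate (hφ.comp hφ'))
      rw [dist_comm]
      exact (hclose (φ (φ' k)) (r (φ' k))).le
    exact tendsto_nhds_unique h1 h2

end Curve

/-! ### 2. The boundary extension of `φ : ℍ → D` is injective on the closed half-plane -/

namespace JordanDomain

/-- **Injectivity of the boundary correspondence.** The boundary extension of a conformal map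
`φ : ℍₒ → D` onto a Jordan domain is injective on the closed upper half-plane: it is
`Ψ ∘ cayleyFun` with `Ψ` Carathéodory's extension of `φ ∘ cayley⁻¹`, a bijection of the closed
disc onto `closure D` (Pommerenke (1992), Thm. 2.6, the tree's
`JordanDomain.exists_continuousOn_extension_holds`), and the Cayley map is injective on the
closed half-plane. [cite: PommerenkeBBCM1992, Thm. 2.6] -/
theorem injOn_boundaryExtension {D : JordanDomain}
    (φ : ConformalEquiv upperHalfPlaneSet D.carrier) :
    InjOn φ.boundaryExtension {z : ℂ | 0 ≤ z.im} := by
  obtain ⟨Ψ, hΨc, hΨeq, hbij, -⟩ := exists_continuousOn_extension_holds D (cayley.symm.trans φ)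
  intro z hz w hw heq
  have hz' : 0 ≤ z.im := hz
  have hw' : 0 ≤ w.im := hw
  rw [boundaryExtension_eq_of_extension φ hΨc hΨeq hz',
    boundaryExtension_eq_of_extension φ hΨc hΨeq hw'] at heq
  have h1 := hbij.injOn (mem_closedBall_zero_iff.2 (norm_cayleyFun_le_one hz'))
    (mem_closedBall_zero_iff.2 (norm_cayleyFun_le_one hw')) heq
  have h2 := congrArg cayleyInvFun h1
  rwa [cayleyInvFun_cayleyFun (add_I_ne_zero hz'), cayleyInvFun_cayleyFun (add_I_ne_zero hw')] at h2

end JordanDomain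

/-! ### 3. Half-plane capacity: two hydrodynamic maps of one hull have the same `hcap` -/

namespace IsHydrodynamicMap

variable {K : Set ℂ} {φ₁ φ₂ : ConformalEquiv (upperHalfPlaneSet \ K) upperHalfPlaneSet}

/-- One half of `hcap_eq_hcap`: `hcap φ₁ ≤ hcap φ₂`, because the quotient `φ₂ ∘ φ₁⁻¹` is a
hydrodynamically normalised map of `ℍ` (empty image hull) with
`0 ≤ hcap(φ₂ ∘ φ₁⁻¹) = hcap φ₂ - hcap φ₁` (Lawler (2005), (3.8)/(3.10)). [cite: Lawler2005, §3.4 (3.8)] -/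
theorem hcap_le_hcap (h₁ : IsHydrodynamicMap K φ₁) (h₂ : IsHydrodynamicMap K φ₂)
    (hb : IsBounded (K ∩ upperHalfPlaneSet)) : hcap K φ₁ ≤ hcap K φ₂ := by
  have hQ := h₁.diffQuotient h₂ hb subset_rfl
  have hbQ := h₁.isBounded_diffImage hb hb (K₂ := K)
  have h0 := hQ.hcap_nonneg hbQ
  rw [h₁.hcap_diffQuotient h₂ hb hb subset_rfl] at h0
  linarith

/-- **The half-plane capacity of a hull does not depend on the normalised map used to compute
it** (uniqueness of `g_A`, Lawler (2005), Prop. 3.36 / Thm. 4.6: two hydrodynamically normalised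
conformal maps `ℍ ∖ K → ℍ` have the same `hcap = lim z (φ(z) - z)`). [cite: Lawler2005, §3.4 Prop. 3.36] -/
theorem hcap_eq_hcap (h₁ : IsHydrodynamicMap K φ₁) (h₂ : IsHydrodynamicMap K φ₂)
    (hb : IsBounded (K ∩ upperHalfPlaneSet)) : hcap K φ₁ = hcap K φ₂ :=
  le_antisymm (hcap_le_hcap h₁ h₂ hb) (hcap_le_hcap h₂ h₁ hb)

end IsHydrodynamicMap

namespace Loewner

variable {W W' : ℝ≥0 → ℝ} {z : ℂ}

/-- `K_t ∩ ℍ` is bounded (Lawler (2005), Lemma 4.13). [cite: Lawler2005, Lemma 4.13] -/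
theorem isBounded_hull_inter (hW : Continuous W) (t : ℝ≥0) :
    IsBounded (hull W t ∩ upperHalfPlaneSet) := by
  obtain ⟨M, -, hM⟩ := exists_forall_norm_driving_sub_le hW t 0
  obtain ⟨δ, hδ, hδt, -⟩ := exists_delta t one_pos
  refine (isBounded_ball (x := (0 : ℂ)) (r := M + 2 * δ)).subset fun w hw ↦ ?_
  rw [mem_ball, dist_eq_norm]
  exact norm_sub_lt_of_mem_hull hW hM hδ hδt hw.1

/-- **`hcap K_t = 2t` for every hydrodynamically normalised map of the hull** (not only `g_t`):
combine `hcap_hull_eq` (Lawler (2005), Thm. 4.6 / eq. (4.6)) with `IsHydrodynamicMap.hcap_eq_hcap`.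
The hull is abstracted as `K` so that the statement can be transported along an equality of
hulls of two different chains. [cite: Lawler2005, Ch. 4 §4.1 Thm. 4.6] -/
theorem hcap_eq_two_mul_of_hull_eq (hW : Continuous W) (t : ℝ≥0) {K : Set ℂ} (hK : hull W t = K)
    {ψ : ConformalEquiv (upperHalfPlaneSet \ K) upperHalfPlaneSet} (hψ : IsHydrodynamicMap K ψ) :
    hcap K ψ = 2 * t := by
  subst hK
  obtain ⟨φ, hφ⟩ := exists_conformalEquiv_map_holds hW t
  rw [← hcap_hull_eq hW t hφ]
  exact hψ.hcap_eq_hcap (isHydrodynamicMap_of_eqOn hW t hφ) (isBounded_hull_inter hW t)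

/-- **A Loewner hull determines its time**: if the chains of two continuous driving functions
have a common hull, `K_t = K'_{t'}`, then `t = t'` — both chains are parametrised by half-plane
capacity, `hcap K_t = 2t` (Lawler (2005), Thm. 4.6: `g_t(z) = z + 2t/z + …`; Rem. 4.5).
[cite: Lawler2005, Ch. 4 §4.1 Thm. 4.6] -/
theorem eq_of_hull_eq (hW : Continuous W) (hW' : Continuous W') {t t' : ℝ≥0}
    (h : hull W t = hull W' t') : t = t' := by
  obtain ⟨φ₂, hφ₂⟩ := exists_conformalEquiv_map_holds hW' t'
  have h1 := hcap_eq_two_mul_of_hull_eq hW t h (isHydrodynamicMap_of_eqOn hW' t' hφ₂)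
  rw [hcap_hull_eq hW' t' hφ₂] at h1
  have h2 : (t' : ℝ) = t := by linarith
  exact_mod_cast h2.symm

/-! ### 4. The hulls determine the driving function -/

/-- **Uniqueness of `g_t` (Lawler (2005), Thm. 4.6): two chains with the same hull at time `t`
have the same Loewner map `g_t` on `H_t`.** The map `g'_t ∘ f_t : ℍ → ℍ` (`f_t = g_t⁻¹`) is a
holomorphic bijection with `g'_t(f_t(w)) - w → 0` at `∞`, and so is its inverse; by the rigidity
theorem `Complex.eqOn_id_of_tendsto_sub_self` it is the identity. [cite: Lawler2005, Ch. 4 §4.1 Thm. 4.6] -/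
theorem eqOn_map_of_hull_eq (hW : Continuous W) (hW' : Continuous W') {t : ℝ≥0}
    (h : hull W t = hull W' t) : EqOn (map W t) (map W' t) (domain W t) := by
  have hdom : domain W' t = domain W t := by
    simp only [domain, h]
  -- the symmetric half of the argument
  have key : ∀ {V V' : ℝ≥0 → ℝ}, Continuous V → Continuous V' → domain V' t = domain V t →
      (DifferentiableOn ℂ (fun w ↦ map V' t (Function.invFunOn (map V t) (domain V t) w))
          upperHalfPlaneSet ∧
        MapsTo (fun w ↦ map V' t (Function.invFunOn (map V t) (domain V t) w))
          upperHalfPlaneSet upperHalfPlaneSet ∧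
        Tendsto (fun w ↦ map V' t (Function.invFunOn (map V t) (domain V t) w) - w)
          (cocompact ℂ ⊓ 𝓟 upperHalfPlaneSet) (𝓝 0)) := by
    intro V V' hV hV' hd
    set f := Function.invFunOn (map V t) (domain V t) with hf
    have hfbij : BijOn f upperHalfPlaneSet (domain V t) := bijOn_invFunOn_map hV t
    have hmaps : MapsTo f upperHalfPlaneSet (domain V' t) := by
      rw [hd]; exact hfbij.mapsTo
    refine ⟨(differentiableOn_map hV' t).comp (differentiableOn_invFunOn_map hV t) hmaps,
      (mapsTo_map hV' t).comp hmaps, ?_⟩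
    -- `f → ∞` within `ℍ`
    have hfinf : Tendsto f (cocompact ℂ ⊓ 𝓟 upperHalfPlaneSet)
        (cocompact ℂ ⊓ 𝓟 upperHalfPlaneSet) := by
      refine tendsto_inf.2 ⟨tendsto_cocompact_of_sub_self inf_le_left
        (tendsto_invFunOn_map_sub_self hV t), tendsto_principal.2 ?_⟩
      filter_upwards [mem_inf_of_right (mem_principal_self _)] with w hw
      exact domain_subset V t (hfbij.mapsTo hw)
    have h1 := ((tendsto_map_sub_self_holds hV' t).comp hfinf).add
      (tendsto_invFunOn_map_sub_self hV t)
    rw [add_zero] at h1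
    refine h1.congr fun w ↦ ?_
    simp only [Function.comp_apply, hf]
    ring
  obtain ⟨hg, hgm, hgl⟩ := key hW hW' hdom
  obtain ⟨hG, hGm, hGl⟩ := key hW' hW hdom.symm
  have hinv := (bijOn_map hW t).invOn_invFunOn
  have hinv' := (bijOn_map hW' t).invOn_invFunOn
  have hfbij := bijOn_invFunOn_map hW t
  set f := Function.invFunOn (map W t) (domain W t) with hf
  set f' := Function.invFunOn (map W' t) (domain W' t) with hf'
  -- `G ∘ g = id`
  have hGg : LeftInvOn (fun w ↦ map W t (f' w)) (fun w ↦ map W' t (f w)) upperHalfPlaneSet := by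
    intro w hw
    have hfw : f w ∈ domain W' t := by rw [hdom]; exact hfbij.mapsTo hw
    simp only
    rw [hinv'.1 hfw]
    exact hinv.2 hw
  have hid := Complex.eqOn_id_of_tendsto_sub_self hg hgm hgl hG hGm hGl hGg
  intro x hx
  have hxH : map W t x ∈ upperHalfPlaneSet := mapsTo_map hW t hx
  have h1 := hid hxH
  simp only [id_eq] at h1
  rw [hinv.1 hx] at h1
  exact h1.symm

/-- **Equal hulls give equal shifted hulls** `K_{s,s+u} = g_s(K_{s+u} ∖ K_s)` (Lawler (2005),
§4.1 p. 96 and Rem. 4.9; the tree's cocycle `mem_hull_iff_map_mem_hull`): if two chains with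
continuous driving functions have the same hulls at all times, so do the chains of the shifted
driving functions `W (s + ·)`, `W' (s + ·)`. [cite: Lawler2005, Rem. 4.9] -/
theorem hull_shift_eq_of_hull_eq (hW : Continuous W) (hW' : Continuous W')
    (h : ∀ t, hull W t = hull W' t) (s u : ℝ≥0) :
    hull (fun v ↦ W (s + v)) u = hull (fun v ↦ W' (s + v)) u := by
  suffices key : ∀ {V V' : ℝ≥0 → ℝ}, Continuous V → Continuous V' → (∀ t, hull V t = hull V' t) →
      hull (fun v ↦ V (s + v)) u ⊆ hull (fun v ↦ V' (s + v)) u from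
    (key hW hW' h).antisymm (key hW' hW fun t ↦ (h t).symm)
  intro V V' hV hV' hVV' w hw
  obtain ⟨x, hx, rfl⟩ := surjOn_map hV s hw.1
  have h1 : x ∈ hull V (s + u) := by
    rw [mem_hull_iff_map_mem_hull hV hx le_self_add, add_tsub_cancel_left]
    exact hw
  have hx' : x ∈ domain V' s := by
    have : domain V' s = domain V s := by simp only [domain, hVV']
    rw [this]
    exact hx
  rw [hVV'] at h1
  have h2 := (mem_hull_iff_map_mem_hull hV' hx' le_self_add).1 h1
  rw [add_tsub_cancel_left, ← eqOn_map_of_hull_eq hV hV' (hVV' s) hx] at h2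
  exact h2

/-- **The increasing family of hulls determines the driving function (Loewner transform).**
If two continuous driving functions generate the same hulls at all times, they are equal.
(Lawler (2005), §4.1, p. 96: the family `{K_t}` of a Loewner chain is right continuous at `t`
with limit `U_t`, `⋂_{δ>0} cl K_{t,t+δ} = {U_t}`.) Here: the shifted hulls `K_{s,s+u}` of the
two chains agree (`hull_shift_eq_of_hull_eq`), are nonempty for `u > 0` (`hull_nonempty`), and
lie within `sup_{[0,u]} |W(s + ·) - W s| + 4√u` of `W s`, resp. of `W' s` (Lemma 4.13,
`norm_sub_lt_of_mem_hull`); letting `u ↓ 0` gives `W s = W' s`. [cite: Lawler2005, Ch. 4 §4.1 p. 96] -/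
theorem driving_eq_of_hull_eq (hW : Continuous W) (hW' : Continuous W')
    (h : ∀ t, hull W t = hull W' t) : W = W' := by
  funext s
  by_contra hne
  set ε : ℝ := |W s - W' s| with hε_def
  have hε : 0 < ε := abs_pos.2 (sub_ne_zero.2 hne)
  -- the shifted driving functions and their continuity at `0`
  have hV : Continuous fun v ↦ W (s + v) := continuous_shift W hW s
  have hV' : Continuous fun v ↦ W' (s + v) := continuous_shift W' hW' s
  have hnear : ∀ {V : ℝ≥0 → ℝ}, Continuous V → ∃ η : ℝ, 0 < η ∧ ∀ v : ℝ≥0, (v : ℝ) < η →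
      ‖(V v : ℂ) - V 0‖ ≤ ε / 8 := by
    intro V hVc
    have h1 := Metric.tendsto_nhds.1 (hVc.tendsto 0) (ε / 8) (by positivity)
    obtain ⟨η, hη, hη'⟩ := Metric.eventually_nhds_iff.1 h1
    refine ⟨η, hη, fun v hv ↦ ?_⟩
    have h2 : dist v 0 < η := by
      rw [NNReal.dist_eq, NNReal.coe_zero, sub_zero, abs_of_nonneg v.coe_nonneg]
      exact hv
    have h3 := hη' h2
    rw [dist_eq_norm] at h3
    rw [← Complex.ofReal_sub, Complex.norm_real]
    exact h3.le
  obtain ⟨η, hη, hηW⟩ := hnear hV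
  obtain ⟨η', hη', hηW'⟩ := hnear hV'
  -- a small positive time `τ` with `4 τ ≤ δ²`, `δ = ε / 16`, `τ < min η η'`
  set δ : ℝ := ε / 16 with hδ_def
  have hδ : 0 < δ := by positivity
  set τ₀ : ℝ := min (δ ^ 2 / 4) (min η η' / 2) with hτ₀_def
  have hτ₀ : 0 < τ₀ := by positivity
  set τ : ℝ≥0 := ⟨τ₀, hτ₀.le⟩ with hτ_def
  have hτcoe : (τ : ℝ) = τ₀ := rfl
  have hτpos : 0 < τ := NNReal.coe_pos.1 (by rw [hτcoe]; exact hτ₀)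
  have hτδ : 4 * (τ : ℝ) ≤ δ ^ 2 := by
    rw [hτcoe]
    linarith [min_le_left (δ ^ 2 / 4) (min η η' / 2)]
  have hτη : (τ : ℝ) < η := by
    rw [hτcoe]
    linarith [min_le_right (δ ^ 2 / 4) (min η η' / 2), min_le_left η η']
  have hτη' : (τ : ℝ) < η' := by
    rw [hτcoe]
    linarith [min_le_right (δ ^ 2 / 4) (min η η' / 2), min_le_right η η']
  -- the bound `|V - V 0| ≤ ε / 8` on `[0, τ]` in the form of Lemma 4.13
  have hbd : ∀ {V : ℝ≥0 → ℝ} {θ : ℝ}, (τ : ℝ) < θ →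
      (∀ v : ℝ≥0, (v : ℝ) < θ → ‖(V v : ℂ) - V 0‖ ≤ ε / 8) →
      ∀ u ∈ Icc (0 : ℝ) τ, ‖(V u.toNNReal : ℂ) - V 0‖ ≤ ε / 8 := by
    intro V θ hθ hVb u hu
    refine hVb _ (lt_of_le_of_lt ?_ hθ)
    rw [Real.coe_toNNReal _ hu.1]
    exact hu.2
  -- a point of the common shifted hull at time `τ`
  obtain ⟨w, hw⟩ := hull_nonempty hV hτpos
  have hw' : w ∈ hull (fun v ↦ W' (s + v)) τ := by
    rw [← hull_shift_eq_of_hull_eq hW hW' h s τ]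
    exact hw
  have h1 := norm_sub_lt_of_mem_hull hV (hbd hτη hηW) hδ hτδ hw
  have h2 := norm_sub_lt_of_mem_hull hV' (hbd hτη' hηW') hδ hτδ hw'
  simp only [add_zero] at h1 h2
  have h3 : ε = ‖((W s : ℝ) : ℂ) - ((W' s : ℝ) : ℂ)‖ := by
    rw [← Complex.ofReal_sub, Complex.norm_real, Real.norm_eq_abs]
  have h4 : ‖((W s : ℝ) : ℂ) - ((W' s : ℝ) : ℂ)‖ ≤ ‖w - W s‖ + ‖w - W' s‖ := by
    rw [← norm_neg (w - W s), neg_sub]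
    exact norm_sub_le_norm_sub_add_norm_sub _ _ _
  have h5 : ε / 8 + 2 * δ = ε / 4 := by rw [hδ_def]; ring
  linarith

end Loewner

/-! ### 5. Assembly: the driving function of a curve class is unique -/

/-- The time compactification `rayParam s = s / (1 - s)` is order preserving and reflecting on
`[0, 1)`. [folklore] -/
private theorem rayParam_le_rayParam_iff' {s t : I} (hs : (s : ℝ) < 1) (ht : (t : ℝ) < 1) :
    rayParam s ≤ rayParam t ↔ s ≤ t := by
  rw [← NNReal.coe_le_coe, coe_rayParam, coe_rayParam,
    div_le_div_iff₀ (by linarith) (by linarith), ← Subtype.coe_le_coe]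
  constructor
  · intro h
    nlinarith [s.2.1, t.2.1]
  · intro h
    nlinarith [s.2.1, t.2.1]

/-- **Initial segments of a compactified image.** If `c` is the time-compactified image of `γ`
under `Φ`, then for `s < 1` the initial-segment trace `c[0, s]` is `Φ (γ[0, s/(1-s)])`.
[folklore] -/
theorem IsCompactifiedImage.image_Iic_eq {Φ : ℂ → ℂ} {γ : ℝ≥0 → ℂ} {b : ℂ} {c : Curve ℂ}
    (h : IsCompactifiedImage Φ γ b c) {s : I} (hs : (s : ℝ) < 1) :
    (c : I → ℂ) '' Iic s = Φ '' (γ '' Icc 0 (rayParam s)) := by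
  ext w
  constructor
  · rintro ⟨r, hr, rfl⟩
    have hr' : r ≤ s := hr
    have hr1 : (r : ℝ) < 1 := lt_of_le_of_lt (Subtype.coe_le_coe.2 hr') hs
    exact ⟨γ (rayParam r), ⟨rayParam r, ⟨_root_.zero_le, (rayParam_le_rayParam_iff' hr1 hs).2 hr'⟩,
      rfl⟩, (h.1 r hr1).symm⟩
  · rintro ⟨_, ⟨u, hu, rfl⟩, rfl⟩
    obtain ⟨r, hr1, hru⟩ := exists_rayParam_eq u
    have hrs : r ≤ s := (rayParam_le_rayParam_iff' hr1 hs).1 (hru ▸ hu.2)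
    exact ⟨r, hrs, by rw [h.1 r hr1, hru]⟩

namespace IsLoewnerDescribed

/-- **Uniqueness of the driving function of a curve class** — discharge of the named fact
`IsLoewnerDescribed.driving_unique`. If the curve class `c` is described through the chordal
uniformizing map `φ` of `(D; a, b)` by the continuous driving functions `W` and `W'`, then
`W = W'`: the two representatives are at reparametrisation distance `0`, hence have the same
initial-segment traces (`Curve.exists_image_Iic_eq_of_dist_eq_zero`); pulling back by the
boundary extension of `φ` (injective on the closed half-plane and avoiding `b`, Carathéodory)
the generating curves have the same initial segments, so the chains have the same hulls up to
a time change, which is the identity since both are parametrised by half-plane capacity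
(`Loewner.eq_of_hull_eq`); and the increasing family of hulls determines the Loewner transform
(`Loewner.driving_eq_of_hull_eq`; Lawler (2005), §4.1 p. 96, Thm. 4.6).
[cite: Lawler2005, Ch. 4 §4.1 p. 96 and Thm. 4.6] -/
theorem driving_unique_holds : IsLoewnerDescribed.driving_unique := by
  intro D φ hφ c W W' hW hW'
  obtain ⟨hWc, γ, hγ, c₁, hc₁, hI₁⟩ := hW
  obtain ⟨hW'c, γ', hγ', c₂, hc₂, hI₂⟩ := hW'
  have hdist : dist c₁ c₂ = 0 := CurveClass.mk_eq_mk_iff_dist_eq_zero.1 (hc₁.symm.trans hc₂)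
  have hinj : InjOn φ.boundaryExtension {z : ℂ | 0 ≤ z.im} :=
    JordanDomain.injOn_boundaryExtension φ
  have hb : ∀ z : ℂ, 0 ≤ z.im → φ.boundaryExtension z ≠ D.pt 1 := fun z hz ↦
    MarkedDomain.boundaryExtension_ne_pt_one JordanDomain.exists_continuousOn_extension_holds hφ hz
  have hsub : ∀ {V : ℝ≥0 → ℝ} {g : ℝ≥0 → ℂ}, Loewner.IsGeneratedByCurve V g → ∀ t : ℝ≥0,
      g '' Icc 0 t ⊆ {z : ℂ | 0 ≤ z.im} := by
    rintro V g hg t _ ⟨u, -, rfl⟩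
    exact hg.im_nonneg u
  -- the hulls agree at all times
  have hhull : ∀ t, Loewner.hull W t = Loewner.hull W' t := by
    intro t
    obtain ⟨s, hs1, rfl⟩ := exists_rayParam_eq t
    obtain ⟨s₂, hs₂⟩ := Curve.exists_image_Iic_eq_of_dist_eq_zero hdist s
    -- `s₂ < 1`, since `c₂ 1 = b` is not a value of the boundary extension on `ℍ̄`
    have hs₂1 : (s₂ : ℝ) < 1 := by
      by_contra hge
      have hs₂eq : s₂ = 1 := Subtype.ext (le_antisymm s₂.2.2 (not_lt.1 hge))
      have hmem : c₂ 1 ∈ (c₂ : I → ℂ) '' Iic s₂ := ⟨1, by rw [hs₂eq]; exact self_mem_Iic, rfl⟩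
      rw [← hs₂, hI₁.image_Iic_eq hs1] at hmem
      obtain ⟨z, ⟨u, -, rfl⟩, hz⟩ := hmem
      exact hb _ (hγ.im_nonneg u) (hz.trans hI₂.2)
    rw [hI₁.image_Iic_eq hs1, hI₂.image_Iic_eq hs₂1] at hs₂
    have hset : γ '' Icc 0 (rayParam s) = γ' '' Icc 0 (rayParam s₂) :=
      (hinj.image_eq_image_iff (hsub hγ _) (hsub hγ' _)).1 hs₂
    have hK : Loewner.hull W (rayParam s) = Loewner.hull W' (rayParam s₂) := by
      rw [hγ.hull_eq, hγ'.hull_eq, hset]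
    have hst := Loewner.eq_of_hull_eq hWc hW'c hK
    rw [← hst] at hK
    exact hK
  exact Loewner.driving_eq_of_hull_eq hWc hW'c hhull

end IsLoewnerDescribed

end Literature.Probability.RandomPlanarGeometry
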